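import Summits.Ventures.KdS.HorizonsB0
import Summits.Ventures.KdS.ModeStabilityB0
import Summits.Ventures.KdS.MasslessScalar
import Literature.Geometry.Lorentzian.KerrDeSitterRadialEnergyIdentity
import HarnessLib

/-!
# Venture KdS — rung R2 in the kernel: the window constants of the pilot box `B0`

HONEST FRAMING (venture `Summits/Ventures/KdS`, cell `pub-kds`): from the horizon enclosures of
`HorizonsB0.lean` (`rMinus ∈ (13/100, 17/125)`, `rPlus ∈ (19/10, 39/20)`, `rCosmo ∈ (54/5, 111/10)`,
uniformly on `B0 = {M = 1, a ∈ [1/2, 251/500], Λ ∈ [1/50, 101/5000]}`) and crude interval bounds on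
`Δ_r'` at the three horizons, the surface gravities `κ₀ ≥ 3`, `0 < κ₁ ≤ 1/4`, `0 < κ₂ ≤ 3/40`, the
superradiant threshold `Ω_SR = 2a/(a² + 3/Λ − (r₀+r₂)²) ≤ 23/500`, `ϖ₂ ≤ 1/200`, `ϖ₁ ≤ 7/50` and
`Ξ ≤ 501/500` follow, and with them the window-constant hypotheses of the box theorem for the FINAL
B0 table: `windowConstants_B0 : WindowConstants B0 tableB0`, `windowConstantsScalar_B0`, hence rung
`r2_windowConstantsB0 : R2_WindowConstantsB0` (PROVED — H4 leaves the data column), and the μ = 0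
square-table constants `windowConstants0_B0 : WindowConstants0 B0 2 R0B0`. Consequently the B0 box
theorem needs only the cited facts H1 (Thm 3.10), H3 (Prop. 3.8) and the certificates R3:
`b0Theorem_of_certificates h1 h3 hR3`. For the massless scalar (`μ = 0`) the hypothesis L-CONF0
of `MasslessScalar.lean` is PROVED on B0 (`lconf0_B0`: growing `μ = 0` modes have `‖ω‖ < |m|ϖ₁`, by
the radial energy identity `masterMode_zero_window` of
`Literature/Geometry/Lorentzian/KerrDeSitterRadialEnergyIdentity.lean` (Casals–Teixeira da Costa 2022,
proof of Thm 3.10, Step 1, at `s = 0`) fed with the angular sign `masterAngularEigenvalue_sign`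
(their Lemma 3.1 (3.7) at `μ = 0`), and `m²ϖ₁² ≤ conf0Sq`), so `MSTrunc0 B0 2 R0B0 Λs` follows from the
μ = 0 certificates alone (`msTrunc0B0_of_certificates`). No claim about mode stability beyond these
implications.
-/

noncomputable section

open Set

namespace Summit.Ventures.KdS

open Literature.Geometry.Lorentzian Literature.Geometry.Lorentzian.KerrDeSitter

section Box

variable {a Λ : ℝ} (ha : 1 / 2 ≤ a ∧ a ≤ 251 / 500) (hΛ : 1 / 50 ≤ Λ ∧ Λ ≤ 101 / 5000)
include ha hΛ

/-- `1 ≤ Ξ ≤ 501/500` on the box. -/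
theorem xi_bounds_B0 : 1 ≤ xi a Λ ∧ xi a Λ ≤ 501 / 500 := by
  unfold xi
  have h1 : a ^ 2 ≤ (251 / 500) ^ 2 := pow_le_pow_left₀ (by linarith [ha.1]) ha.2 2
  have hΛ0 : 0 ≤ Λ := by linarith [hΛ.1]
  have h2 : 0 ≤ Λ / 3 * a ^ 2 := by positivity
  constructor
  · linarith
  · nlinarith [mul_le_mul hΛ.2 h1 (sq_nonneg a) (by norm_num : (0:ℝ) ≤ 101 / 5000)]

/-- `Δ_r'` at the Cauchy horizon: `−7/4 < Δ_r'(r₋) < −17/10`. -/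
theorem deltaDeriv_rMinus_B0 :
    -(7 / 4) < deltaDeriv 1 a Λ (rMinus 1 a Λ) ∧ deltaDeriv 1 a Λ (rMinus 1 a Λ) < -(17 / 10) := by
  obtain ⟨-, hr, -, -, -⟩ := horizons_B0 ha hΛ
  set r := rMinus 1 a Λ
  rw [deltaDeriv_one]
  have hr0 : 0 ≤ r := by linarith [hr.1]
  have ha0 : 0 ≤ a := by linarith [ha.1]
  have hΛ0 : 0 ≤ Λ := by linarith [hΛ.1]
  have h1 : Λ * r ^ 3 ≤ 101 / 5000 * (17 / 125) ^ 3 :=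
    mul_le_mul hΛ.2 (pow_le_pow_left₀ hr0 hr.2.le 3) (by positivity) (by norm_num)
  have h2 : Λ * a ^ 2 * r ≤ 101 / 5000 * (251 / 500) ^ 2 * (17 / 125) := by
    have := mul_le_mul hΛ.2 (pow_le_pow_left₀ ha0 ha.2 2) (sq_nonneg a) (by norm_num)
    exact mul_le_mul this hr.2.le hr0 (by positivity)
  have h3 : 0 ≤ Λ * r ^ 3 := by positivity
  have h4 : 0 ≤ Λ * a ^ 2 * r := by positivity
  constructor <;> nlinarith [hr.1, hr.2]

/-- `Δ_r'` at the event horizon: `3/2 < Δ_r'(r₊) < 7/4`. -/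
theorem deltaDeriv_rPlus_B0 :
    3 / 2 < deltaDeriv 1 a Λ (rPlus 1 a Λ) ∧ deltaDeriv 1 a Λ (rPlus 1 a Λ) < 7 / 4 := by
  obtain ⟨-, -, hr, -, -⟩ := horizons_B0 ha hΛ
  set r := rPlus 1 a Λ
  rw [deltaDeriv_one]
  have hr0 : 0 ≤ r := by linarith [hr.1]
  have ha0 : 0 ≤ a := by linarith [ha.1]
  have hΛ0 : 0 ≤ Λ := by linarith [hΛ.1]
  have h1 : Λ * r ^ 3 ≤ 101 / 5000 * (39 / 20) ^ 3 :=
    mul_le_mul hΛ.2 (pow_le_pow_left₀ hr0 hr.2.le 3) (by positivity) (by norm_num)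
  have h1' : 1 / 50 * (19 / 10) ^ 3 ≤ Λ * r ^ 3 :=
    mul_le_mul hΛ.1 (pow_le_pow_left₀ (by norm_num) hr.1.le 3) (by positivity) hΛ0
  have h2 : Λ * a ^ 2 * r ≤ 101 / 5000 * (251 / 500) ^ 2 * (39 / 20) := by
    have := mul_le_mul hΛ.2 (pow_le_pow_left₀ ha0 ha.2 2) (sq_nonneg a) (by norm_num)
    exact mul_le_mul this hr.2.le hr0 (by positivity)
  have h4 : 0 ≤ Λ * a ^ 2 * r := by positivity
  constructor <;> nlinarith [hr.1, hr.2]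

/-- `Δ_r'` at the cosmological horizon: `−17 < Δ_r'(r_c) < −13`. -/
theorem deltaDeriv_rCosmo_B0 :
    -17 < deltaDeriv 1 a Λ (rCosmo 1 a Λ) ∧ deltaDeriv 1 a Λ (rCosmo 1 a Λ) < -13 := by
  obtain ⟨-, -, -, hr, -⟩ := horizons_B0 ha hΛ
  set r := rCosmo 1 a Λ
  rw [deltaDeriv_one]
  have hr0 : 0 ≤ r := by linarith [hr.1]
  have ha0 : 0 ≤ a := by linarith [ha.1]
  have hΛ0 : 0 ≤ Λ := by linarith [hΛ.1]
  have h1 : Λ * r ^ 3 ≤ 101 / 5000 * (111 / 10) ^ 3 :=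
    mul_le_mul hΛ.2 (pow_le_pow_left₀ hr0 hr.2.le 3) (by positivity) (by norm_num)
  have h1' : 1 / 50 * (54 / 5) ^ 3 ≤ Λ * r ^ 3 :=
    mul_le_mul hΛ.1 (pow_le_pow_left₀ (by norm_num) hr.1.le 3) (by positivity) hΛ0
  have h2 : Λ * a ^ 2 * r ≤ 101 / 5000 * (251 / 500) ^ 2 * (111 / 10) := by
    have := mul_le_mul hΛ.2 (pow_le_pow_left₀ ha0 ha.2 2) (sq_nonneg a) (by norm_num)
    exact mul_le_mul this hr.2.le hr0 (by positivity)
  have h4 : 0 ≤ Λ * a ^ 2 * r := by positivity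
  -- `2r − (4Λ/3)r³` is decreasing on the enclosure: couple the two terms at `r = 111/10`
  have hr2 : (54 / 5) ^ 2 ≤ r ^ 2 := pow_le_pow_left₀ (by norm_num) hr.1.le 2
  have hk : 2 ≤ 4 * Λ / 3 * (r ^ 2 + r * (111 / 10) + (111 / 10) ^ 2) := by
    have : (54 / 5 : ℝ) ^ 2 + 54 / 5 * (111 / 10) + (111 / 10) ^ 2 ≤
        r ^ 2 + r * (111 / 10) + (111 / 10) ^ 2 := by nlinarith [hr.1]
    nlinarith [mul_le_mul hΛ.1 this (by norm_num) hΛ0]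
  have key : 2 * (111 / 10) - 4 * Λ / 3 * (111 / 10) ^ 3 ≤ 2 * r - 4 * Λ / 3 * r ^ 3 := by
    nlinarith [mul_nonneg (sub_nonneg.2 hr.2.le) (sub_nonneg.2 hk)]
  constructor <;> nlinarith [hr.1, hr.2]

/-- `κ₀ ≥ 3` (Cauchy horizon). -/
theorem kappaCauchy_B0 : 3 ≤ surfaceGravity 1 a Λ (rMinus 1 a Λ) := by
  obtain ⟨-, hr, -, -, -⟩ := horizons_B0 ha hΛ
  obtain ⟨hd1, hd2⟩ := deltaDeriv_rMinus_B0 ha hΛ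
  obtain ⟨hx1, hx2⟩ := xi_bounds_B0 ha hΛ
  unfold surfaceGravity
  rw [abs_of_neg (by linarith)]
  have ha2 : a ^ 2 ≤ (251 / 500) ^ 2 := pow_le_pow_left₀ (by linarith [ha.1]) ha.2 2
  have hr2 : rMinus 1 a Λ ^ 2 ≤ (17 / 125) ^ 2 := pow_le_pow_left₀ (by linarith [hr.1]) hr.2.le 2
  have hden : 0 < 2 * xi a Λ * (rMinus 1 a Λ ^ 2 + a ^ 2) := by
    have : 0 < a ^ 2 := by have : 0 < a := by linarith [ha.1]
                           positivity
    nlinarith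
  rw [le_div_iff₀ hden]
  nlinarith [mul_le_mul hx2 (add_le_add hr2 ha2) (by positivity) (by norm_num)]

/-- `0 < κ₁ ≤ 1/4` (event horizon). -/
theorem kappaEvent_B0 :
    0 < surfaceGravity 1 a Λ (rPlus 1 a Λ) ∧ surfaceGravity 1 a Λ (rPlus 1 a Λ) ≤ 1 / 4 := by
  obtain ⟨-, -, hr, -, -⟩ := horizons_B0 ha hΛ
  obtain ⟨hd1, hd2⟩ := deltaDeriv_rPlus_B0 ha hΛ
  obtain ⟨hx1, hx2⟩ := xi_bounds_B0 ha hΛ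
  unfold surfaceGravity
  rw [abs_of_pos (by linarith)]
  have hr2 : (19 / 10) ^ 2 ≤ rPlus 1 a Λ ^ 2 := pow_le_pow_left₀ (by norm_num) hr.1.le 2
  have ha2 : (1 / 2) ^ 2 ≤ a ^ 2 := pow_le_pow_left₀ (by norm_num) ha.1 2
  have hden : 0 < 2 * xi a Λ * (rPlus 1 a Λ ^ 2 + a ^ 2) := by nlinarith
  refine ⟨div_pos (by linarith) hden, ?_⟩
  rw [div_le_iff₀ hden]
  nlinarith [mul_le_mul hx1 (add_le_add hr2 ha2) (by norm_num) (by linarith)]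

/-- `0 < κ₂ ≤ 3/40` (cosmological horizon). -/
theorem kappaCosmo_B0 :
    0 < surfaceGravity 1 a Λ (rCosmo 1 a Λ) ∧ surfaceGravity 1 a Λ (rCosmo 1 a Λ) ≤ 3 / 40 := by
  obtain ⟨-, -, -, hr, -⟩ := horizons_B0 ha hΛ
  obtain ⟨hd1, hd2⟩ := deltaDeriv_rCosmo_B0 ha hΛ
  obtain ⟨hx1, hx2⟩ := xi_bounds_B0 ha hΛ
  unfold surfaceGravity
  rw [abs_of_neg (by linarith)]
  have hr2 : (54 / 5) ^ 2 ≤ rCosmo 1 a Λ ^ 2 := pow_le_pow_left₀ (by norm_num) hr.1.le 2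
  have ha2 : (1 / 2) ^ 2 ≤ a ^ 2 := pow_le_pow_left₀ (by norm_num) ha.1 2
  have hden : 0 < 2 * xi a Λ * (rCosmo 1 a Λ ^ 2 + a ^ 2) := by nlinarith
  refine ⟨div_pos (by linarith) hden, ?_⟩
  rw [div_le_iff₀ hden]
  nlinarith [mul_le_mul hx1 (add_le_add hr2 ha2) (by norm_num) (by linarith)]

/-- The superradiant threshold: `0 ≤ Ω_SR ≤ 23/500` on the box
(`Ω_SR = 2a/(a² + 3/Λ − (r₀ + r₂)²)`, denominator `> 22`). -/
theorem superradiantUpper_B0 :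
    0 ≤ superradiantUpper 1 a Λ ∧ superradiantUpper 1 a Λ ≤ 23 / 500 := by
  obtain ⟨-, hr0, -, hr2, -⟩ := horizons_B0 ha hΛ
  unfold superradiantUpper
  have hΛ0 : 0 < Λ := by linarith [hΛ.1]
  have h3 : 15000 / 101 ≤ 3 / Λ := by
    rw [le_div_iff₀ hΛ0]; nlinarith [hΛ.2]
  have hsum : (rMinus 1 a Λ + rCosmo 1 a Λ) ^ 2 ≤ (17 / 125 + 111 / 10) ^ 2 :=
    pow_le_pow_left₀ (by linarith [hr0.1, hr2.1]) (by linarith [hr0.2, hr2.2]) 2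
  have ha2 : (1 / 2) ^ 2 ≤ a ^ 2 := pow_le_pow_left₀ (by norm_num) ha.1 2
  have hden : 22 < a ^ 2 + 3 / Λ - (rMinus 1 a Λ + rCosmo 1 a Λ) ^ 2 := by nlinarith
  have ha2' : 0 ≤ 2 * a := by linarith [ha.1]
  refine ⟨div_nonneg ha2' (by linarith), ?_⟩
  rw [div_le_iff₀ (by linarith)]
  nlinarith [ha.2]

/-- `0 ≤ ϖ₂ ≤ 1/200` (angular velocity of the cosmological horizon). -/
theorem horizonAngVel_rCosmo_B0 :
    0 ≤ horizonAngVel a (rCosmo 1 a Λ) ∧ horizonAngVel a (rCosmo 1 a Λ) ≤ 1 / 200 := by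
  obtain ⟨-, -, -, hr, -⟩ := horizons_B0 ha hΛ
  unfold horizonAngVel
  have hr2 : (54 / 5) ^ 2 ≤ rCosmo 1 a Λ ^ 2 := pow_le_pow_left₀ (by norm_num) hr.1.le 2
  have hden : 0 < rCosmo 1 a Λ ^ 2 + a ^ 2 := by nlinarith [sq_nonneg a]
  refine ⟨div_nonneg (by linarith [ha.1]) hden.le, ?_⟩
  rw [div_le_iff₀ hden]
  nlinarith [ha.2, sq_nonneg a]

/-- `0 ≤ ϖ₁ ≤ 7/50` (angular velocity of the event horizon). -/
theorem horizonAngVel_rPlus_B0 :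
    0 ≤ horizonAngVel a (rPlus 1 a Λ) ∧ horizonAngVel a (rPlus 1 a Λ) ≤ 7 / 50 := by
  obtain ⟨-, -, hr, -, -⟩ := horizons_B0 ha hΛ
  unfold horizonAngVel
  have hr2 : (19 / 10) ^ 2 ≤ rPlus 1 a Λ ^ 2 := pow_le_pow_left₀ (by norm_num) hr.1.le 2
  have hden : 0 < rPlus 1 a Λ ^ 2 + a ^ 2 := by nlinarith [sq_nonneg a]
  refine ⟨div_nonneg (by linarith [ha.1]) hden.le, ?_⟩
  rw [div_le_iff₀ hden]
  nlinarith [ha.2, sq_nonneg a]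

/-- The μ = 0 confinement constant on the box: `conf0Sq 1 a Λ m ≤ (49/2500) m² + 7/500`. -/
theorem conf0Sq_B0 (m : ℝ) : conf0Sq 1 a Λ m ≤ 49 / 2500 * m ^ 2 + 7 / 500 := by
  obtain ⟨hw0, hw1⟩ := horizonAngVel_rPlus_B0 ha hΛ
  obtain ⟨hx1, -⟩ := xi_bounds_B0 ha hΛ
  unfold conf0Sq
  have h1 : horizonAngVel a (rPlus 1 a Λ) ^ 2 ≤ (7 / 50) ^ 2 := pow_le_pow_left₀ hw0 hw1 2
  have h2 : 2 * Λ / (3 * xi a Λ ^ 3) ≤ 7 / 500 := by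
    rw [div_le_iff₀ (by positivity)]
    have : 1 ≤ xi a Λ ^ 3 := one_le_pow₀ hx1
    nlinarith [hΛ.2]
  nlinarith [mul_le_mul_of_nonneg_left h1 (sq_nonneg m)]

end Box

/-! ### The window constants of the final B0 table -/

/-- **Rung R2, `s = −2` column: `WindowConstants B0 tableB0` — PROVED.** -/
theorem windowConstants_B0 : WindowConstants B0 tableB0 := by
  rintro ⟨M, a, Λ⟩ ⟨hM, ha, hΛ⟩
  simp only at hM ha hΛ
  subst hM
  have ha' : 1 / 2 ≤ a ∧ a ≤ 251 / 500 := ⟨ha.1, ha.2⟩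
  have hΛ' : 1 / 50 ≤ Λ ∧ Λ ≤ 101 / 5000 := ⟨hΛ.1, hΛ.2⟩
  obtain ⟨hsub, -, -, -, -⟩ := horizons_B0 ha' hΛ'
  have hk0 := kappaCauchy_B0 ha' hΛ'
  obtain ⟨hk1, hk1'⟩ := kappaEvent_B0 ha' hΛ'
  obtain ⟨hk2, hk2'⟩ := kappaCosmo_B0 ha' hΛ'
  obtain ⟨hΩ0, hΩ⟩ := superradiantUpper_B0 ha' hΛ'
  obtain ⟨hϖ0, hϖ⟩ := horizonAngVel_rCosmo_B0 ha' hΛ'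
  have hapos : 0 < a := by linarith [ha.1]
  have hΛ0 : 0 < Λ := by linarith [hΛ.1]
  have h3 : 148 ≤ 3 / Λ := by rw [le_div_iff₀ hΛ0]; nlinarith [hΛ.2]
  refine ⟨hsub, hapos, ?_, ?_, ⟨by linarith, hk1, hk2, by linarith⟩, ?_, ?_⟩
  · rw [abs_of_pos hapos]; linarith [ha.2]
  · nlinarith [ha.2]
  · show surfaceGravity 1 a Λ (rCosmo 1 a Λ) ≤ 3 / 20
    linarith
  · intro m hm
    change |m| ≤ 2 at hm
    show |m| * superradiantUpper 1 a Λ ≤ halfWidthB0 m ∧ |m| * superradiantUpper 1 a Λ ≤ 3 / 20 ∧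
      |m * horizonAngVel a (rCosmo 1 a Λ)| ≤ halfWidthB0 m
    have hmabs : 0 ≤ |m| := abs_nonneg m
    have hprod : |m| * superradiantUpper 1 a Λ ≤ 2 * (23 / 500) :=
      mul_le_mul hm hΩ hΩ0 (by norm_num)
    have hprod2 : |m * horizonAngVel a (rCosmo 1 a Λ)| ≤ 2 * (1 / 200) := by
      rw [abs_mul, abs_of_nonneg hϖ0]
      exact mul_le_mul hm hϖ hϖ0 (by norm_num)
    refine ⟨?_, by linarith, ?_⟩
    · unfold halfWidthB0
      split_ifs with h0 h1
      · rw [h0]; simp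
      · rw [h1, one_mul]; linarith
      · linarith
    · unfold halfWidthB0
      split_ifs with h0 h1 <;> linarith

/-- **Rung R2, scalar column: `WindowConstantsScalar B0 tableB0` — PROVED.** -/
theorem windowConstantsScalar_B0 : WindowConstantsScalar B0 tableB0 := by
  rintro ⟨M, a, Λ⟩ ⟨hM, ha, hΛ⟩ m hm hm0
  simp only at hM ha hΛ
  subst hM
  have ha' : 1 / 2 ≤ a ∧ a ≤ 251 / 500 := ⟨ha.1, ha.2⟩
  have hΛ' : 1 / 50 ≤ Λ ∧ Λ ≤ 101 / 5000 := ⟨hΛ.1, hΛ.2⟩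
  obtain ⟨hΩ0, hΩ⟩ := superradiantUpper_B0 ha' hΛ'
  change |m| ≤ 2 at hm
  show |m| * superradiantUpper 1 a Λ ≤ heightScalarB0 m
  have hprod : |m| * superradiantUpper 1 a Λ ≤ 2 * (23 / 500) :=
    mul_le_mul hm hΩ hΩ0 (by norm_num)
  unfold heightScalarB0
  split_ifs with h1
  · rw [h1, one_mul]; linarith
  · linarith

/-- **Rung R2 — PROVED**: the window constants of the final B0 table hold on all of B0. -/
theorem r2_windowConstantsB0 : R2_WindowConstantsB0 := ⟨windowConstants_B0, windowConstantsScalar_B0⟩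

/-- **Rung R2₀ (μ = 0): `WindowConstants0 B0 2 R0B0` — PROVED.** -/
theorem windowConstants0_B0 : WindowConstants0 B0 2 R0B0 := by
  rintro ⟨M, a, Λ⟩ ⟨hM, ha, hΛ⟩ m hm
  simp only at hM ha hΛ
  subst hM
  have ha' : 1 / 2 ≤ a ∧ a ≤ 251 / 500 := ⟨ha.1, ha.2⟩
  have hΛ' : 1 / 50 ≤ Λ ∧ Λ ≤ 101 / 5000 := ⟨hΛ.1, hΛ.2⟩
  have hc := conf0Sq_B0 ha' hΛ' m
  change |m| ≤ 2 at hm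
  have hm2 : m ^ 2 ≤ 4 := by
    have := abs_le.mp hm
    nlinarith [this.1, this.2]
  show 0 ≤ R0B0 m ∧ conf0Sq 1 a Λ m ≤ R0B0 m ^ 2
  unfold R0B0
  split_ifs with h0 h1
  · subst h0; constructor <;> nlinarith
  · have : m ^ 2 = 1 := by
      have := congrArg (· ^ 2) h1; simpa [sq_abs] using this
    constructor <;> nlinarith
  · constructor <;> nlinarith

/-- THE B0 BOX THEOREM FROM THE CERTIFICATES: with (H2) proved (Lemma 3.1 (3.7),
`CasalsTeixeiraDaCosta2022_angularSign_holds`) and rung R2 proved (`r2_windowConstantsB0`), the box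
theorem `B0Theorem` follows from the two cited facts H1 (Casals–Teixeira da Costa 2022, Thm 3.10),
H3 (their Prop. 3.8 on the cosmological threshold ray) and the signed certificates R3 alone. -/
theorem b0Theorem_of_certificates (h1 : CasalsTeixeiraDaCosta2022_partialModeStability)
    (h3 : CasalsTeixeiraDaCosta2022_partialModeStabilityProp38) (hR3 : R3_B0Certificates) :
    B0Theorem :=
  b0Theorem_of' h1 h3 r2_windowConstantsB0 hR3

/-- **L-CONF0 on B0 — PROVED**: every growing massless-scalar (`s = 0`, `μ = 0`) mode on the pilot box
has `‖ω‖² < m²ϖ₁² ≤ conf0Sq 1 a Λ m` (radial energy identity, Casals–Teixeira da Costa 2022 Thm 3.10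
Step 1 at `s = 0` — `masterMode_zero_window` — with the angular sign of their Lemma 3.1 (3.7) at `μ = 0`,
`masterAngularEigenvalue_sign`; both are Lean theorems of `Literature/`). -/
theorem lconf0_B0 : LConf0 B0 := by
  rintro ⟨M, a, Λ⟩ ⟨hM, ha, hΛ⟩ ω m _hm hω ⟨lamBar, R, hang, hR, hin, hout, hnt⟩
  simp only at hM ha hΛ
  subst hM
  have ha' : 1 / 2 ≤ a ∧ a ≤ 251 / 500 := ⟨ha.1, ha.2⟩
  have hΛ' : 1 / 50 ≤ Λ ∧ Λ ≤ 101 / 5000 := ⟨hΛ.1, hΛ.2⟩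
  obtain ⟨hsub, -, -, -, -⟩ := horizons_B0 ha' hΛ'
  obtain ⟨hx1, -⟩ := xi_bounds_B0 ha' hΛ'
  have hapos : 0 < a := by linarith [ha.1]
  -- the angular sign at `μ = 0` (CTdC Lemma 3.1 (3.7), proved in `KerrDeSitterMasterEquations.lean`)
  have hν : 0 < ((a : ℂ) * ω).im := by simpa [Complex.mul_im] using mul_pos hapos hω
  have hsign := masterAngularEigenvalue_sign hsub.2.1.le le_rfl hν hang
  have hlam : (lamBar * (starRingEnd ℂ) ω).im ≤ 0 := by
    have hid : ((starRingEnd ℂ) ((a : ℂ) * ω) * lamBar).im = a * (lamBar * (starRingEnd ℂ) ω).im := by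
      simp only [map_mul, Complex.conj_ofReal, Complex.mul_im, Complex.mul_re, Complex.ofReal_re,
        Complex.ofReal_im, Complex.conj_re, Complex.conj_im]
      ring
    rw [hid] at hsign
    exact (neg_of_mul_neg_right hsign hapos.le).le
  -- the radial energy identity (CTdC Thm 3.10, Step 1, `s = 0`, `μ = 0`)
  obtain ⟨-, hlt⟩ := masterMode_zero_window hsub hapos.le le_rfl hω hlam hR hin hout hnt
  have hϖ0 : 0 ≤ horizonAngVel a (rPlus 1 a Λ) := (horizonAngVel_rPlus_B0 ha' hΛ').1
  have hsq : ‖ω‖ ^ 2 < (|m| * horizonAngVel a (rPlus 1 a Λ)) ^ 2 :=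
    pow_lt_pow_left₀ hlt (norm_nonneg ω) two_ne_zero
  rw [mul_pow, sq_abs] at hsq
  show ‖ω‖ ^ 2 < conf0Sq 1 a Λ m
  unfold conf0Sq
  have : 0 ≤ 2 * Λ / (3 * xi a Λ ^ 3) := by
    have : 0 ≤ Λ := by linarith [hΛ.1]
    positivity
  linarith

/-- THE μ = 0 B0 BOX STATEMENT FROM THE CERTIFICATES ALONE: with L-CONF0 (`lconf0_B0`) and the μ = 0
window constants (`windowConstants0_B0`) proved, `MSTrunc0 B0 2 R0B0 Λs` follows from a μ = 0
Statement B₀ (runs 4–6). -/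
theorem msTrunc0B0_of_certificates {Λs : ℝ → ℝ → ℂ → ℝ → Set ℂ}
    (hB : StatementB0 B0 2 R0B0 Λs) : MSTrunc0 B0 2 R0B0 Λs :=
  msTrunc0_of_facts lconf0_B0 windowConstants0_B0 hB

end Summit.Ventures.KdS

end
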